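/-
Origin: expansion seat `planner-pub-hodgecm-pv13-g5-0`, handover #4 2026-08-18T13:2xZ (md5 110f3a10691f4d96aa1cdd21b58ac132; NEW additive leaf; ONE import rewrite Pv13g5.GenuineSchrodingerRigid -> HodgeCM.PerL34.GenuineSchrodingerRigid (my #3, same run) by the generic ^import Pv[0-9]+g[0-9]+\. rule; second import HodgeCM.PerL34.GenuineSchrodingerEnd is the INSTALLED r29 module (row 0d7c2a69, pv07-g4 #3); land AFTER my #3 and AFTER GenuineSchrodingerEnd; HOLD if (`HOME/pub-hodgecm-pv13-g5/lean/Pv13g5/GenuineSchrodingerRigidEnd.lean`, md5 110f3a10, 262 lines);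
landed by the gen-8 packager in gate run 30 as `HodgeCM/PerL34/GenuineSchrodingerRigidEnd.lean` (import ^import Pv13g5\.GenuineSchrodingerRigid[ \t]*$→import HodgeCM.PerL34.GenuineSchrodingerRigid ×1).
-/
/-
Copyright (c) 2026. All rights reserved.
Released under Apache 2.0 license as described in the file LICENSE.
Authors: unit pub-hodgecm-pv13-g5 (DAG-NODE PROVER #13, seam S3, 𝓕-side).

# HodgeCM/PerL34/GenuineSchrodingerRigidEnd.lean — the S3 END on `L²(X)` with its ONE representation-
# side hypothesis `D.ω = rep L (twistChar L χ)` REPLACED by the Heisenberg commutation relations of `D.ω`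
-/
import Summits.HodgeConjecture.HodgeCM.PerL34.GenuineSchrodingerRigid_2
import Summits.HodgeConjecture.HodgeCM.PerL34.GenuineSchrodingerEnd

/-!
# The S3 END theorem on the genuine model `L²(X)`, representation side = Heisenberg relations only

`HodgeCM/PerL34/GenuineSchrodingerEnd.lean` (gate RUN 29, pv07-g4) is the S3 END
`exists_compactDomain_thetaLift_ne_zero_genuine_of_input` on `Sp = L²(X)` with ALL SEVENTEEN torus-side
binders supplied by the kernel; its only representation-side hypothesis is the EQUATION
`hω : D.ω = rep L (twistChar L χ)` — "the doubling datum's representation of `U(1)(𝔸_{L⁺})` on `L²(X)`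
IS the model representation".  `HodgeCM/PerL34/GenuineSchrodingerRigid.lean` (this seat, file #3)
proves that the model representation is FORCED: a unitary representation `ω` of `Model L` on `L²(X)`
normalising the adelic Heisenberg operators as the Weil representation does is `rep L ν` for a unique
unitary character `ν` (adelic Stone–von Neumann + Schur).

This file composes the two BY NAME:

* §1 `character_eq_of_rep_apply_eq` — the character of `rep L ν` is read off ONE non-zero vector:
  `rep L ν k f = rep L ν' k f` for all `k` and one `f ≠ 0` forces `ν = ν'`.
* §2 `eq_rep_of_heisenberg_of_apply_eq` (+ `_coord`) — CALIBRATED RIGIDITY: if `ω` satisfies the two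
  Heisenberg commutation relations and agrees with `rep L ν'` on one non-zero vector, then
  `ω = rep L ν'` on the nose.
* §3 `Coeff.exists_compactDomain_thetaLift_ne_zero_genuine_heisenberg` (+ `_level`) — the RUN-29 END
  theorems `…_genuine_shift` / `…_genuine_shift_level` with `hω` REPLACED by: the translation relation
  `D.ω(k) τ_y = τ_{k⁻¹•y} D.ω(k)`, the coordinate modulation relation
  `D.ω(k) M_{v,j,s} = M_{v,j,s·k_v} D.ω(k)` (for any family `ψ_v` of non-trivial continuous additive
  characters of the `L⁺_v`, `v` split), and the calibration `D.ω(k) f = rep L (twistChar L χ) k f` on a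
  single non-zero vector `f ∈ L²(X)`.  So what the END asks of the doubling datum's representation on
  `L²(X)` is no longer an identification with a constructed object but three checkable operator
  identities — the print sentence "acting … by `|y|^{3/2}φ(yx)` up to a unitary character"
  (PerL v5 tex l. 611) with the unitary character pinned by one matrix entry.

ABSOLUTE RULE.  Nothing is cited and nothing is posited: the theorems below are compositions of landed
package theorems (RUN 27–29) and this seat's file #3; every hypothesis is data or an operator identity
supplied by the caller, or a hypothesis of the RUN-29 END passed through unchanged.
-/

set_option autoImplicit false

noncomputable section

open MeasureTheory MeasureTheory.Measure Set Metric Function Complex ComplexConjugate Topology Filter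
open scoped RestrictedProduct InnerProductSpace NNReal ENNReal Pointwise

namespace HodgeCM.PerL34.PureTensor.SchrodingerModel

open HodgeCM.PerL34.SplitShells HodgeCM.PerL34.AdelicFactorisation HodgeCM.PerL34.RestrictedMeasure
open HodgeCM.PerL34.NoSmallSubgroups HodgeCM.PerL34.EulerFactorisation HodgeCM.PerL34.DiscreteFD
open HodgeCM.PerL34.LocalFactors HodgeCM.PerL34.LocalFactors.DilationModel
open HodgeCM.PerL34.LocalFactors.SchrodingerLevi HodgeCM.PerL34.LocalFactors.SchrodingerIrreducible
open HodgeCM.PerL34.LocalModulus HodgeCM.PerL34.SplitPlaceDilation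
open HodgeCM.PerL34.RallisIP HodgeCM.PerL34.Doubling HodgeCM.PerL34.N31d NumberField IsDedekindDomain
open HodgeCM.PerL34.IdelePlaces HodgeCM.PerL34.RestrictedRegroup HodgeCM.PerL34.RestrictedCutout
open HodgeCM.PerL34.IdelicTorusModel HodgeCM.PerL34.IdelicTorusModel.Genuine

attribute [local instance] LocalFactors.DilationModel.Adic.nontriviallyNormedField
  LocalFactors.DilationModel.Adic.properSpace

variable {L : Type} [Field L] [NumberField L] [IsCMField L]

/-! ## §1  The character of `rep L ν` is read off one non-zero vector -/

/-- If `rep L ν` and `rep L ν'` agree at every `k` on ONE non-zero vector `f ∈ L²(X)`, then `ν = ν'`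
(`rep L ν k = ν(k) • rep L 1 k` and `rep L 1 k f ≠ 0`). -/
theorem character_eq_of_rep_apply_eq {ν ν' : Model L →* Circle} {f : Lp ℂ 2 (μ L)} (hf : f ≠ 0)
    (h : ∀ k : Model L, rep L ν k f = rep L ν' k f) : ν = ν' := by
  ext k
  have hne : dilationRep (μ L) 1 k f ≠ 0 := (map_ne_zero_iff _ (dilationRep (μ L) 1 k).injective).2 hf
  have key : dilationRep (μ L) ν k f = dilationRep (μ L) ν' k f := h k
  rw [dilationRep_apply_eq_smul (μ L) ν, dilationRep_apply_eq_smul (μ L) ν'] at key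
  exact congrArg _ (Circle.ext (smul_left_injective ℂ hne key))

/-- `L²(X) ≠ 0` (so a calibrating vector always exists). -/
theorem exists_ne_zero_space : ∃ f : Lp ℂ 2 (μ L), f ≠ 0 :=
  exists_ne_zero (μ L)

/-! ## §2  Calibrated rigidity: Heisenberg relations + one matrix entry determine `ω` -/

section Characters

variable (ψ : ∀ i : SplitIdx L, AddChar ((basePlaceOf L i.1).adicCompletion (maximalRealSubfield L)) Circle)
  (hψc : ∀ i, Continuous (ψ i))

/-- **Calibrated rigidity.**  A unitary representation `ω` of `Model L` on `L²(X)` with the two Heisenberg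
commutation relations (`𝓜` any set of modulation characters containing the adelic coordinate Heisenberg
characters) which agrees with `rep L ν'` on ONE non-zero vector IS `rep L ν'`. -/
theorem eq_rep_of_heisenberg_of_apply_eq (hψ : ∀ i, ∃ t, ψ i t ≠ 1) (𝓜 : Set C(Space L, Circle))
    (h𝓜 : ∀ (i : SplitIdx L) (j : Fin 3) (s : (basePlaceOf L i.1).adicCompletion (maximalRealSubfield L)),
      adelicCoordChar ψ hψc i j s ∈ 𝓜)
    (ω : Model L →* (Lp ℂ 2 (μ L) ≃ₗᵢ[ℂ] Lp ℂ 2 (μ L)))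
    (hτ : ∀ (k : Model L) (y : Space L) (f : Lp ℂ 2 (μ L)),
      ω k (translate (μ L) y f) = translate (μ L) (k⁻¹ • y) (ω k f))
    (hM : ∀ (k : Model L), ∀ χ ∈ 𝓜, ∀ f : Lp ℂ 2 (μ L),
      ω k (modulate (μ L) χ f) = modulate (μ L) (χ.comp (smulMap k)) (ω k f))
    (ν' : Model L →* Circle) {f : Lp ℂ 2 (μ L)} (hf : f ≠ 0)
    (hcal : ∀ k : Model L, ω k f = rep L ν' k f) : ω = rep L ν' := by
  obtain ⟨ν, hν, -⟩ := rep_unique_up_to_character ψ hψc hψ 𝓜 h𝓜 ω hτ hM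
  subst hν
  rw [character_eq_of_rep_apply_eq hf hcal]

/-- **Calibrated rigidity, consumer form** (modulation relation stated inside the coordinate family). -/
theorem eq_rep_of_heisenberg_of_apply_eq_coord (hψ : ∀ i, ∃ t, ψ i t ≠ 1)
    (ω : Model L →* (Lp ℂ 2 (μ L) ≃ₗᵢ[ℂ] Lp ℂ 2 (μ L)))
    (hτ : ∀ (k : Model L) (y : Space L) (f : Lp ℂ 2 (μ L)),
      ω k (translate (μ L) y f) = translate (μ L) (k⁻¹ • y) (ω k f))
    (hM : ∀ (k : Model L) (i : SplitIdx L) (j : Fin 3)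
      (s : (basePlaceOf L i.1).adicCompletion (maximalRealSubfield L)) (f : Lp ℂ 2 (μ L)),
      ω k (modulate (μ L) (adelicCoordChar ψ hψc i j s) f)
        = modulate (μ L) (adelicCoordChar ψ hψc i j (s * ((unitAt k i :
            ((basePlaceOf L i.1).adicCompletion (maximalRealSubfield L))ˣ) :
              (basePlaceOf L i.1).adicCompletion (maximalRealSubfield L)))) (ω k f))
    (ν' : Model L →* Circle) {f : Lp ℂ 2 (μ L)} (hf : f ≠ 0)
    (hcal : ∀ k : Model L, ω k f = rep L ν' k f) : ω = rep L ν' := by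
  obtain ⟨ν, hν, -⟩ := rep_unique_up_to_character_coord ψ hψc hψ ω hτ hM
  subst hν
  rw [character_eq_of_rep_apply_eq hf hcal]

/-- Conversely the three hypotheses are NECESSARY: `rep L ν'` satisfies them (with `hcal` by `rfl`), so
§2 characterises `rep L ν'` among all unitary representations of `Model L` on `L²(X)`. -/
theorem eq_rep_iff_heisenberg_and_apply_eq (hψ : ∀ i, ∃ t, ψ i t ≠ 1)
    (ω : Model L →* (Lp ℂ 2 (μ L) ≃ₗᵢ[ℂ] Lp ℂ 2 (μ L))) (ν' : Model L →* Circle)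
    {f : Lp ℂ 2 (μ L)} (hf : f ≠ 0) :
    ω = rep L ν' ↔
      (∀ (k : Model L) (y : Space L) (g : Lp ℂ 2 (μ L)),
          ω k (translate (μ L) y g) = translate (μ L) (k⁻¹ • y) (ω k g)) ∧
        (∀ (k : Model L) (i : SplitIdx L) (j : Fin 3)
          (s : (basePlaceOf L i.1).adicCompletion (maximalRealSubfield L)) (g : Lp ℂ 2 (μ L)),
          ω k (modulate (μ L) (adelicCoordChar ψ hψc i j s) g)
            = modulate (μ L) (adelicCoordChar ψ hψc i j (s * ((unitAt k i :
                ((basePlaceOf L i.1).adicCompletion (maximalRealSubfield L))ˣ) :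
                  (basePlaceOf L i.1).adicCompletion (maximalRealSubfield L)))) (ω k g)) ∧
        ∀ k : Model L, ω k f = rep L ν' k f := by
  refine ⟨?_, fun h => eq_rep_of_heisenberg_of_apply_eq_coord ψ hψc hψ ω h.1 h.2.1 ν' hf h.2.2⟩
  rintro rfl
  refine ⟨rep_translate ν', fun k i j s g => ?_, fun k => rfl⟩
  rw [rep_modulate, adelicCoordChar_comp_smulMap]

/-! ## §3  The S3 END on `L²(X)` with Heisenberg hypotheses in place of `hω` -/

set_option synthInstance.maxHeartbeats 200000 in
-- (as in the END theorem: the `SMul Γ (Model L)` instance behind `IsFundamentalDomain` is slow to find)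
/-- **S3 END on the genuine model `L²(X)`, representation side = Heisenberg relations + one matrix entry.**
`HodgeCM.PerL34.PureTensor.SchrodingerModel.Coeff.exists_compactDomain_thetaLift_ne_zero_genuine_shift`
(RUN 29) with its hypothesis `hω : D.ω = rep L (twistChar L χ)` DISCHARGED from: the translation relation
`hτ`, the coordinate modulation relation `hM` (any family `ψ` of non-trivial continuous additive characters
of the split completions), and the calibration `hcal` of `D.ω` against `rep L (twistChar L χ)` on one
non-zero vector `f`.  All other binders and the conclusion are the RUN-29 END's, verbatim. -/
theorem Coeff.exists_compactDomain_thetaLift_ne_zero_genuine_heisenberg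
    [DecidableEq (Place (maximalRealSubfield L))]
    [∀ v : HeightOneSpectrum (𝓞 (maximalRealSubfield L)),
      MeasurableSpace (v.adicCompletion (maximalRealSubfield L))]
    [∀ v : HeightOneSpectrum (𝓞 (maximalRealSubfield L)),
      BorelSpace (v.adicCompletion (maximalRealSubfield L))]
    (hψ : ∀ i, ∃ t, ψ i t ≠ 1)
    (S₀ : Finset (Place (maximalRealSubfield L)))
    {W : Type} [AddCommGroup W] [Module L W]
    {H Sbox : Type} [Group H] [AddCommGroup Sbox] [Module ℂ Sbox]
    {h : W →ₗ⋆[L] W →ₗ[L] L} (hW : IsLine L W) (hh : Anisotropic h)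
    (D : DoublingDatum (Model L) H (Lp ℂ 2 (μ L)) Sbox) (GU : ThetaSide (Lp ℂ 2 (μ L)) Sbox)
    (j : isomBox h →* H) (hj : ∀ d : unitary L, j ⟨iotaSnd d, iotaSnd_mem h d⟩ = D.ι (1, unitaryToModel L d))
    (χ : Model L →* Circle) (hχΓ : ∀ d : unitary L, χ (unitaryToModel L d) = 1)
    (hχVΓ : ∀ d : unitary L, D.χV (unitaryToModel L d) = 1)
    {hP : ∀ Ψ : Sbox, ∀ p ∈ (stabDelta L W).subgroupOf (isomBox h), ∀ x : H, D.fSW Ψ (j p * x) = D.fSW Ψ x}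
    (P : GluePrintInputs D GU h j hP)
    {T' : Finset (Place (maximalRealSubfield L))}
    (hχT' : RestrictedProduct.boxSubgroup (genLevel L) T' ≤ χ.ker)
    (hlocχ : ∀ i ∈ T', Continuous fun g : locTorus (maximalRealSubfield L) L i =>
      χ (RestrictedProduct.mulSingle (genLevel L) i g))
    {S : Finset (Place (maximalRealSubfield L))} (hT'S : T' ⊆ S)
    (hS : ∀ v : InfinitePlace (maximalRealSubfield L), Sum.inl v ∈ S)
    -- the representation side: Heisenberg relations of `D.ω` and one matrix entry (replacing `hω`)
    (hτ : ∀ (k : Model L) (y : Space L) (f : Lp ℂ 2 (μ L)),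
      D.ω k (translate (μ L) y f) = translate (μ L) (k⁻¹ • y) (D.ω k f))
    (hM : ∀ (k : Model L) (i : SplitIdx L) (j : Fin 3)
      (s : (basePlaceOf L i.1).adicCompletion (maximalRealSubfield L)) (f : Lp ℂ 2 (μ L)),
      D.ω k (modulate (μ L) (adelicCoordChar ψ hψc i j s) f)
        = modulate (μ L) (adelicCoordChar ψ hψc i j (s * ((unitAt k i :
            ((basePlaceOf L i.1).adicCompletion (maximalRealSubfield L))ˣ) :
              (basePlaceOf L i.1).adicCompletion (maximalRealSubfield L)))) (D.ω k f))
    {f : Lp ℂ 2 (μ L)} (hf : f ≠ 0) (hcal : ∀ k : Model L, D.ω k f = rep L (Coeff.twistChar L χ) k f)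
    [IsFiniteMeasure GU.μ] :
    ∃ 𝓕 : Set (Model L), IsCompact 𝓕 ∧ (interior 𝓕).Nonempty ∧ MeasurableSet 𝓕 ∧
      IsFundamentalDomain (unitaryToModel L).range 𝓕
        (haarDatum (genLevel L) (isCompact_genLevel L) (isOpen_genLevel L) S₀).μ ∧
      (haarDatum (genLevel L) (isCompact_genLevel L) (isOpen_genLevel L) S₀).μ 𝓕 ≠ 0 ∧
      (haarDatum (genLevel L) (isCompact_genLevel L) (isOpen_genLevel L) S₀).μ 𝓕 ≠ ⊤ ∧
      ∀ [IsFiniteMeasure (((haarDatum (genLevel L) (isCompact_genLevel L) (isOpen_genLevel L) S₀).μ).restrict 𝓕)]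
        (hk : Measurable (Function.uncurry (thetaFn D GU (Coeff.phiE (Coeff.shiftFor S χ hχT' hlocχ)))))
        {Ck : ℝ} (hCk : 0 ≤ Ck)
        (hkC : ∀ q u, ‖thetaFn D GU (Coeff.phiE (Coeff.shiftFor S χ hχT' hlocχ)) q u‖ ≤ Ck),
        PeterssonFubini.theta GU.μ
          (((haarDatum (genLevel L) (isCompact_genLevel L) (isOpen_genLevel L) S₀).μ).restrict 𝓕) hk
          (measurable_coe_char (genLevel L) (isOpen_genLevel L) χ hχT' hlocχ) hCk hkC (norm_coe_char_le χ) ≠ 0 :=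
  Coeff.exists_compactDomain_thetaLift_ne_zero_genuine_shift L S₀ hW hh D GU j hj χ hχΓ hχVΓ P hχT' hlocχ
    hT'S hS (eq_rep_of_heisenberg_of_apply_eq_coord ψ hψc hψ D.ω hτ hM (Coeff.twistChar L χ) hf hcal)

set_option synthInstance.maxHeartbeats 200000 in
/-- The same with the canonical finite set of places `levelPlaces L T' = T' ∪ {infinite places}` (the
RUN-29 `…_genuine_shift_level`, `hω` replaced as above): NO bookkeeping hypothesis and NO
representation-side identification left — only the print inputs, the theta / doubling side, and three
operator identities of `D.ω`. -/
theorem Coeff.exists_compactDomain_thetaLift_ne_zero_genuine_heisenberg_level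
    [DecidableEq (Place (maximalRealSubfield L))]
    [∀ v : HeightOneSpectrum (𝓞 (maximalRealSubfield L)),
      MeasurableSpace (v.adicCompletion (maximalRealSubfield L))]
    [∀ v : HeightOneSpectrum (𝓞 (maximalRealSubfield L)),
      BorelSpace (v.adicCompletion (maximalRealSubfield L))]
    (hψ : ∀ i, ∃ t, ψ i t ≠ 1)
    (S₀ : Finset (Place (maximalRealSubfield L)))
    {W : Type} [AddCommGroup W] [Module L W]
    {H Sbox : Type} [Group H] [AddCommGroup Sbox] [Module ℂ Sbox]
    {h : W →ₗ⋆[L] W →ₗ[L] L} (hW : IsLine L W) (hh : Anisotropic h)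
    (D : DoublingDatum (Model L) H (Lp ℂ 2 (μ L)) Sbox) (GU : ThetaSide (Lp ℂ 2 (μ L)) Sbox)
    (j : isomBox h →* H) (hj : ∀ d : unitary L, j ⟨iotaSnd d, iotaSnd_mem h d⟩ = D.ι (1, unitaryToModel L d))
    (χ : Model L →* Circle) (hχΓ : ∀ d : unitary L, χ (unitaryToModel L d) = 1)
    (hχVΓ : ∀ d : unitary L, D.χV (unitaryToModel L d) = 1)
    {hP : ∀ Ψ : Sbox, ∀ p ∈ (stabDelta L W).subgroupOf (isomBox h), ∀ x : H, D.fSW Ψ (j p * x) = D.fSW Ψ x}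
    (P : GluePrintInputs D GU h j hP)
    {T' : Finset (Place (maximalRealSubfield L))}
    (hχT' : RestrictedProduct.boxSubgroup (genLevel L) T' ≤ χ.ker)
    (hlocχ : ∀ i ∈ T', Continuous fun g : locTorus (maximalRealSubfield L) L i =>
      χ (RestrictedProduct.mulSingle (genLevel L) i g))
    (hτ : ∀ (k : Model L) (y : Space L) (f : Lp ℂ 2 (μ L)),
      D.ω k (translate (μ L) y f) = translate (μ L) (k⁻¹ • y) (D.ω k f))
    (hM : ∀ (k : Model L) (i : SplitIdx L) (j : Fin 3)
      (s : (basePlaceOf L i.1).adicCompletion (maximalRealSubfield L)) (f : Lp ℂ 2 (μ L)),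
      D.ω k (modulate (μ L) (adelicCoordChar ψ hψc i j s) f)
        = modulate (μ L) (adelicCoordChar ψ hψc i j (s * ((unitAt k i :
            ((basePlaceOf L i.1).adicCompletion (maximalRealSubfield L))ˣ) :
              (basePlaceOf L i.1).adicCompletion (maximalRealSubfield L)))) (D.ω k f))
    {f : Lp ℂ 2 (μ L)} (hf : f ≠ 0) (hcal : ∀ k : Model L, D.ω k f = rep L (Coeff.twistChar L χ) k f)
    [IsFiniteMeasure GU.μ] :
    ∃ 𝓕 : Set (Model L), IsCompact 𝓕 ∧ (interior 𝓕).Nonempty ∧ MeasurableSet 𝓕 ∧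
      IsFundamentalDomain (unitaryToModel L).range 𝓕
        (haarDatum (genLevel L) (isCompact_genLevel L) (isOpen_genLevel L) S₀).μ ∧
      (haarDatum (genLevel L) (isCompact_genLevel L) (isOpen_genLevel L) S₀).μ 𝓕 ≠ 0 ∧
      (haarDatum (genLevel L) (isCompact_genLevel L) (isOpen_genLevel L) S₀).μ 𝓕 ≠ ⊤ ∧
      ∀ [IsFiniteMeasure (((haarDatum (genLevel L) (isCompact_genLevel L) (isOpen_genLevel L) S₀).μ).restrict 𝓕)]
        (hk : Measurable (Function.uncurry
          (thetaFn D GU (Coeff.phiE (Coeff.shiftFor (Coeff.levelPlaces L T') χ hχT' hlocχ)))))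
        {Ck : ℝ} (hCk : 0 ≤ Ck)
        (hkC : ∀ q u,
          ‖thetaFn D GU (Coeff.phiE (Coeff.shiftFor (Coeff.levelPlaces L T') χ hχT' hlocχ)) q u‖ ≤ Ck),
        PeterssonFubini.theta GU.μ
          (((haarDatum (genLevel L) (isCompact_genLevel L) (isOpen_genLevel L) S₀).μ).restrict 𝓕) hk
          (measurable_coe_char (genLevel L) (isOpen_genLevel L) χ hχT' hlocχ) hCk hkC (norm_coe_char_le χ) ≠ 0 :=
  Coeff.exists_compactDomain_thetaLift_ne_zero_genuine_shift_level L S₀ hW hh D GU j hj χ hχΓ hχVΓ P hχT'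
    hlocχ (eq_rep_of_heisenberg_of_apply_eq_coord ψ hψc hψ D.ω hτ hM (Coeff.twistChar L χ) hf hcal)

end Characters

end HodgeCM.PerL34.PureTensor.SchrodingerModel

end
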